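import Summits.CriticalPhenomena.PercolationContinuityZ3.Theorems.PercAnnulusCrossingIICPlanarQuasiMult
import Summits.CriticalPhenomena.PercolationContinuityZ3.Theorems.PercAnnulusCrossingIICNearCriticalLimit
import Summits.CriticalPhenomena.PercolationContinuityZ3.Theorems.PercAnnulusCrossingIICNearCriticalUniqueCluster
import Summits.CriticalPhenomena.PercolationContinuityZ3.Theorems.PercAnnulusCrossingIICAspectCorollaries
import Summits.CriticalPhenomena.PercolationContinuityZ3.Theorems.PercNonProliferationSubpolynomialBlockingStubBlockProbTwoPos
import HarnessLib

/-!
# KESTEN'S INCIPIENT INFINITE CLUSTER ON `ℤ²`, UNCONDITIONALLY: both constructions exist and agree (lane RSW3, p1 gen 6)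

builds on p205010 (kernel theorem, internal audit signed; external expert review pending) — not used here (`ℤ²` only: Kesten 1980 `p_c = 1/2`,
RSW, Harris, Burton–Keane uniqueness, all tree theorems).

Seat `prim-rsw3-p1` (gen 6).  The planar instance of the lane's IIC chain: by `…IICPlanarQuasiMult.lean` the hypothesis (A2)□ at aspect `(9, 77)`
holds for bond percolation on `ℤ²` at every `p ≥ 1/2 = p_c(ℤ²)` (`kesten_criticalProb_Z2_holds`) with one constant, so the near-critical series
(XI–XIII) applies with no hypothesis left: **Kesten's Theorem (3) of 1986 for bond percolation on `ℤ²`, kernel form — for every cylinder event `E`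
the limits `lim_n P_{1/2}(E | 0 ↔ ∂ⁱⁿΛ(n))` and `lim_{p ↓ 1/2} P_p(E | |C(0)| = ∞)` exist and are equal; they define ONE probability measure `ν`
(Kesten's IIC), under which there is exactly one infinite cluster.**  (Kesten's own proof uses innermost open circuits and conditioning; this one
is Basu–Sapozhnikov's scheme with the conditional non-uniqueness junk, RSW entering only through (A2)□.)  Helper file; no definitions, no sorries.
* `SubpolynomialBlocking.StubBlockProbTwoPos.criticalProbI_two_eq_half` — `p_c(ℤ²) = 1/2` as a point of `[0,1]` (tree: Kesten 1980);
* `exists_setToSetQuasiMultAspectAt_two_of_criticalProbI_le` — (A2)□(9,77,ϰ) at every `p ≥ p_c(ℤ²)`;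
* **`kestenIICExistsAt_two_criticalProbI`** — `KestenIICExistsAt 2 (criticalProbI 2)`, unconditional;
* **`kesten_iic_two_constructions_Z2`** — `∃ ν, P_{p_c}(E ∩ {0↔∂ⁱⁿΛ(n)})/π(n) → ν ∧ P_p(E ∩ {|C(0)|=∞})/θ(p) → ν (p ↓ p_c)` for every cylinder `E`;
* **`exists_iicMeasure_Z2`** — ONE probability measure with both limits on cylinders (Mathlib `cond` form for the second) and `ν`-a.s. exactly one
  infinite cluster.
References: H. Kesten, *The incipient infinite cluster in two-dimensional percolation*, PTRF 73 (1986) 369–394, Thm. (3); H. Kesten, CMP 74 (1980)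
(`p_c = 1/2`); D. Basu, A. Sapozhnikov, ECP 22 (2017) no. 26, Thm. 1.1 and §1; G. Grimmett, *Percolation* (1999), §11.7.
-/

noncomputable section

namespace Summit.CriticalPhenomena.PercolationContinuityZ3.Theorems.Crossing

open MeasureTheory ProbabilityTheory Filter Topology Literature.Probability.Percolation Literature.Probability.LatticeModels
open Literature.Probability.Percolation.DCT16 Literature.Probability.Percolation.DKT20
open scoped Literature.Probability.Percolation ProbabilityTheory

/-- **(A2)□ at aspect `(9, 77)` holds on `ℤ²` at every `p ≥ p_c(ℤ²)`, with one constant** (RSW; `…IICPlanarQuasiMult.lean`).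
[cite: BasuSapozhnikov2017ECP, §1 (comments on (A2))] -/
theorem exists_setToSetQuasiMultAspectAt_two_of_criticalProbI_le :
    ∃ ϰ : ℝ, 0 < ϰ ∧ ∀ p : unitInterval, criticalProbI 2 ≤ p → SetToSetQuasiMultAspectAt 2 p 9 77 ϰ := by
  obtain ⟨ϰ, hϰ, h⟩ := exists_setToSetQuasiMultAspectAt_two_of_half_le
  exact ⟨ϰ, hϰ, fun p hp => h p (by rw [← SubpolynomialBlocking.StubBlockProbTwoPos.criticalProbI_two_eq_half]; exact hp)⟩

/-- **Kesten's IIC exists on `ℤ²` at `p_c = 1/2` — unconditionally** (`KestenIICExistsAt 2 (criticalProbI 2)`): (A2)□ from RSW, then the lane's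
IIC theorem. [cite: Kesten1986, Thm. (3)] [cite: BasuSapozhnikov2017ECP, Thm. 1.1] -/
theorem kestenIICExistsAt_two_criticalProbI : KestenIICExistsAt 2 (criticalProbI 2) := by
  obtain ⟨ϰ, hϰ, hA2⟩ := exists_setToSetQuasiMultAspectAt_two_of_criticalProbI_le
  have hpc0 : 0 < ((criticalProbI 2 : unitInterval) : ℝ) := by
    rw [SubpolynomialBlocking.StubBlockProbTwoPos.criticalProbI_two_eq_half, coe_half]; norm_num
  exact kestenIICExistsAt_of_setToSetQuasiMultAspectAt' (d := 2) (by norm_num) (criticalProbI 2) hpc0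
    (s := 9) (L := 77) (by norm_num) hϰ (hA2 _ le_rfl)

/-- **KESTEN'S TWO CONSTRUCTIONS AGREE ON `ℤ²` (Kesten 1986, Thm. (3)), unconditionally**: for every cylinder event `E` there is `ν(E)` with
`P_{p_c}(E ∩ {0 ↔ ∂ⁱⁿΛ(n)})/π_{p_c}(n) → ν(E)` as `n → ∞` AND `P_p(E ∩ {|C(0)| = ∞})/θ(p) → ν(E)` as `p ↓ p_c = 1/2`.
[cite: Kesten1986, Thm. (3)] [cite: BasuSapozhnikov2017ECP, Thm. 1.1] -/
theorem kesten_iic_two_constructions_Z2 (F : Finset (Sym2 (Site 2))) (E : Set (BondConfig (Site 2))) (hEm : MeasurableSet E)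
    (hEF : DeterminedBy E ↑F) :
    ∃ ν : ℝ,
      Tendsto (fun n : ℕ => (bondPercolation (zdGraph 2) (criticalProbI 2)).real (E ∩ siteToBoundary 2 n) / oneArmProb 2 (criticalProbI 2) n)
        atTop (𝓝 ν) ∧
      Tendsto (fun p : unitInterval => (bondPercolation (zdGraph 2) p).real (E ∩ percolatesAt (0 : Site 2)) / theta (zdGraph 2) (0 : Site 2) p)
        (𝓝[>] (criticalProbI 2)) (𝓝 ν) := by
  obtain ⟨ϰ, hϰ, hA2⟩ := exists_setToSetQuasiMultAspectAt_two_of_criticalProbI_le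
  have hq : criticalProbI 2 < (⟨3 / 4, by norm_num, by norm_num⟩ : unitInterval) := by
    rw [← Subtype.coe_lt_coe, SubpolynomialBlocking.StubBlockProbTwoPos.criticalProbI_two_eq_half, coe_half]; norm_num
  exact kesten_iic_eq_lim_condPercolation_of_setToSetQuasiMultAspectAt (d := 2) le_rfl (s := 9) (L := 77) (by norm_num) hϰ
    (q := (⟨3 / 4, by norm_num, by norm_num⟩ : unitInterval)) hq (by norm_num) (fun p h1 _ => hA2 p h1) F E hEm hEF

/-- **KESTEN'S IIC MEASURE ON `ℤ²`, unconditionally**: there is ONE probability measure `ν` on bond configurations of `ℤ²` such that for every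
cylinder event `E`: `P_{1/2}(E | 0 ↔ ∂ⁱⁿΛ(n)) → ν(E)` (`n → ∞`), `P_p[E | {|C(0)| = ∞}] → ν(E)` (`p ↓ 1/2`), and `ν`-almost surely there is exactly
one infinite open cluster. [cite: Kesten1986, Thm. (3)] [cite: BasuSapozhnikov2017ECP, Thm. 1.1] -/
theorem exists_iicMeasure_Z2 :
    ∃ ν : Measure (BondConfig (Site 2)), IsProbabilityMeasure ν ∧
      (∀ (F : Finset (Sym2 (Site 2))) (E : Set (BondConfig (Site 2))), MeasurableSet E → DeterminedBy E ↑F →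
        Tendsto (fun n : ℕ => (bondPercolation (zdGraph 2) (criticalProbI 2)).real (E ∩ siteToBoundary 2 n) / oneArmProb 2 (criticalProbI 2) n)
          atTop (𝓝 (ν.real E))) ∧
      (∀ (F : Finset (Sym2 (Site 2))) (E : Set (BondConfig (Site 2))), MeasurableSet E → DeterminedBy E ↑F →
        Tendsto (fun p : unitInterval => ((bondPercolation (zdGraph 2) p)[|percolatesAt (0 : Site 2)]).real E)
          (𝓝[>] (criticalProbI 2)) (𝓝 (ν.real E))) ∧
      (∀ᵐ ω ∂ν, numInfiniteClusters ω = 1) := by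
  obtain ⟨ϰ, hϰ, hA2⟩ := exists_setToSetQuasiMultAspectAt_two_of_criticalProbI_le
  have hq : criticalProbI 2 < (⟨3 / 4, by norm_num, by norm_num⟩ : unitInterval) := by
    rw [← Subtype.coe_lt_coe, SubpolynomialBlocking.StubBlockProbTwoPos.criticalProbI_two_eq_half, coe_half]; norm_num
  obtain ⟨ν, hνP, h1, h2⟩ := exists_iicMeasure_tendsto_cond_percolatesAt_of_setToSetQuasiMultAspectAt (d := 2) le_rfl (s := 9) (L := 77)
    (by norm_num) hϰ (q := (⟨3 / 4, by norm_num, by norm_num⟩ : unitInterval)) hq (by norm_num) (fun p h1 _ => hA2 p h1)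
  refine ⟨ν, hνP, h1, h2, ?_⟩
  have hpc0 : 0 < ((criticalProbI 2 : unitInterval) : ℝ) := by
    rw [SubpolynomialBlocking.StubBlockProbTwoPos.criticalProbI_two_eq_half, coe_half]; norm_num
  have hpc1 : ((criticalProbI 2 : unitInterval) : ℝ) < 1 := by
    rw [SubpolynomialBlocking.StubBlockProbTwoPos.criticalProbI_two_eq_half, coe_half]; norm_num
  exact iicMeasure_ae_numInfiniteClusters_eq_one_uniq (d := 2) (by norm_num) (criticalProbI 2) hpc0 hpc1
    (s := 9) (L := 77) (by norm_num) hϰ (hA2 _ le_rfl) h1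

end Summit.CriticalPhenomena.PercolationContinuityZ3.Theorems.Crossing

end
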